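import Summits.CriticalPhenomena.CardyFormulaZ2.Theorems.CardyMagicRigidityMarkovCascadeDefs
import Summits.CriticalPhenomena.CardyFormulaZ2.Theorems.CardyMagicRigidityNestingRigidityBigLoopsTightZ2Part1
import Literature.Probability.Percolation.FKLoopNestingIntegrable
import Literature.Probability.Percolation.FKLoopNestingMeasurable

/-!
# Tightness of the number of big interface loops of critical bond percolation on `ℤ²`

Stub `tight_encard_bigLoops_bondLoopConfig` of line `markov-cascade-one-generation` of crux
`NestingRigidity` (stmt-CriticalPhenomena-4835; route `CardyMagicRigidity`, sub-problem
`CriticalPhenomena/CardyFormulaZ2`): the finite-depth tightness input of the Markov cascade on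
`ℤ²`. For every window radius `R`, scale `η > 0` and `ε > 0` there is `N` such that for all
small meshes `δ`

  `P_{1/2}( #{u ∈ (bondLoopConfig δ 0 ω).loops : trace u ⊆ B(0, R), diam (trace u) ≥ η} > N ) ≤ ε`

(`Set.encard`, no finiteness presupposed; `P2 = bondPercolation (zdGraph 2) half`).

## Proof (a cluster has one top; Nolin 2008, §5.2, proof of Thm 23: `β₃ = 2` by counting)

On lattice configurations (`ω ⊆ E(ℤ²)`, almost sure), rescale to mesh `1` (`big_at_mesh_one`).
By `exists_topCorner_of_isInterfaceLoop` (Part 1) every interface loop with trace in `B(0, R/δ)`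
and diameter `≥ η/δ ≥ 4s + 2` passes through the *top corner* of a local top (direction
`(0, 1)`, scale `s`) of `ω` at a site of `B(⌈R/δ⌉)` or of `dualConfig ω` at a face of
`B(⌈R/δ⌉ + 1)`; all dart lists through one corner draw the same unbased loop
(`IsInterfaceLoop.rotate_eq_of_corner`, `unbasedLoop_loopCurve_rotate`), so the number of big
loops is at most the number of such local tops (`encard_bigLoops_le_encard_tops`). Each local
top event has probability `≤ C/s²` (`real_localTopEvent_le_of_one_le`; for the dual ones by
self-duality, `real_preimage_dualConfig_localTopEvent`), so the expected number of local tops is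
`≤ (|B(⌈R/δ⌉)| + |B(⌈R/δ⌉+1)|) C/s² ≤ 6272 C max(R,1)²/η²` for `δ < min 1 (η/12)`,
`s = ⌊(η/δ - 2)/4⌋ ≥ η/(8δ)` (`integral_topCount_le`), uniformly in `δ`; Markov's inequality
gives the claim with `N = ⌈6272 C max(R,1)² / (η² ε)⌉`.

## References

* P. Nolin, *Near-critical percolation in two dimensions*, Electron. J. Probab. 13 (2008),
  §5.2, Thm 23 (arXiv 0711.4948 numbering) [Nolin2008].
* M. Aizenman, A. Burchard, Duke Math. J. 99 (1999) (tightness of random curve systems).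
* G. Grimmett, *Percolation*, 2nd ed. (1999), §11.2; F. Camia, C. M. Newman, CMP 268 (2006), §4.
-/

noncomputable section

open MeasureTheory Set Filter
open scoped Topology BigOperators ENNReal Real

namespace Summit.CriticalPhenomena.CardyFormulaZ2.Cruxes.NestingRigidity.MarkovCascadeOneGeneration

open Literature.Probability.RandomPlanarGeometry Literature.Probability.Percolation
  Literature.Probability.LatticeModels
open Summit.CriticalPhenomena.CardyFormulaZ2.Theses.CardyMagicRigidity

/-- **Rescaling to mesh `1`.** A loop of `bondLoopConfig δ 0 ω` drawn by the list `γ` with trace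
in `B(0, R)` and diameter `≥ η` comes from a mesh-`1` loop with trace in `B(0, R/δ)` and
diameter `≥ η/δ` (the similarity `w ↦ δ w`). [folklore] -/
theorem big_at_mesh_one {δ R η : ℝ} (hδ : 0 < δ) {γ : List MedialVertex} (hne : γ ≠ [])
    (hball : (UnbasedLoop.mk (BasedLoop.mk (loopCurve δ 0 γ) (isLoop_loopCurve δ 0 hne))).range ⊆
      Metric.ball 0 R)
    (hdiam : η ≤ Metric.diam
      (UnbasedLoop.mk (BasedLoop.mk (loopCurve δ 0 γ) (isLoop_loopCurve δ 0 hne))).range) :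
    (loopCurve 1 0 γ).range ⊆ Metric.ball 0 (R / δ) ∧
      η / δ ≤ Metric.diam (loopCurve 1 0 γ).range := by
  rw [UnbasedLoop.range_mk, BasedLoop.toCurveClass_mk, loopCurve_eq_map_mul,
    CurveClass.range_map] at hball hdiam
  have hTn : ∀ w : ℂ, ‖(δ : ℂ) * w‖ = δ * ‖w‖ := fun w ↦ by
    rw [norm_mul, Complex.norm_real, Real.norm_of_nonneg hδ.le]
  constructor
  · intro w hw
    have := hball ⟨w, hw, rfl⟩
    rw [Metric.mem_ball, dist_zero_right] at this ⊢
    change ‖(δ : ℂ) * w‖ < R at this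
    rw [hTn] at this
    rw [lt_div_iff₀ hδ]
    linarith
  · rw [div_le_iff₀ hδ]
    refine hdiam.trans ?_
    rw [mul_comm]
    refine Metric.diam_le_of_forall_dist_le (mul_nonneg hδ.le Metric.diam_nonneg) ?_
    rintro _ ⟨w, hw, rfl⟩ _ ⟨w', hw', rfl⟩
    change dist ((δ : ℂ) * w) ((δ : ℂ) * w') ≤ _
    rw [dist_eq_norm, ← mul_sub, hTn, ← dist_eq_norm]
    exact mul_le_mul_of_nonneg_left
      (Metric.dist_le_diam_of_mem (loopCurve 1 0 γ).isCompact_range.isBounded hw hw') hδ.le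

/-- **The number of big loops is at most the number of local tops** (primal sites in
`B(⌈R/δ⌉)`, dual faces in `B(⌈R/δ⌉ + 1)`, direction `(0,1)`, scale `s` with `4s + 2 ≤ η/δ`), on
lattice configurations: every big loop is drawn by a list through the top corner of
`exists_topCorner_of_isInterfaceLoop`, and all lists through one corner draw the same unbased
loop (`IsInterfaceLoop.rotate_eq_of_corner`, `unbasedLoop_loopCurve_rotate`). [cite: Nolin2008, §5.2, proof of Thm 23 (arXiv 0711.4948 numbering; counting argument)] -/
theorem encard_bigLoops_le_encard_tops {δ R η : ℝ} (hδ : 0 < δ) {s : ℕ} (hs : 1 ≤ s)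
    (hsD : (4 * s + 2 : ℝ) ≤ η / δ) {ω : BondConfig (Site 2)} (hω : ω ⊆ (zdGraph 2).edgeSet) :
    {u ∈ (bondLoopConfig δ 0 ω).loops |
        u.range ⊆ Metric.ball (0 : ℂ) R ∧ η ≤ Metric.diam u.range}.encard ≤
      {x : Site 2 | x ∈ box 2 ⌈R / δ⌉₊ ∧ IsLocalTop ![0, 1] ω x s}.encard +
        {g : Site 2 | g ∈ box 2 (⌈R / δ⌉₊ + 1) ∧ IsLocalTop ![0, 1] (dualConfig ω) g s}.encard := by
  classical
  set T₁ : Set (Site 2) := {x : Site 2 | x ∈ box 2 ⌈R / δ⌉₊ ∧ IsLocalTop ![0, 1] ω x s} with hT₁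
  set T₂ : Set (Site 2) := {g : Site 2 | g ∈ box 2 (⌈R / δ⌉₊ + 1) ∧
    IsLocalTop ![0, 1] (dualConfig ω) g s} with hT₂
  set C₁ : Set (Site 2 × Fin 4) := (fun x ↦ (x, (0 : Fin 4))) '' T₁ with hC₁
  set C₂ : Set (Site 2 × Fin 4) := (fun g ↦ (g + Pi.single 1 1, (3 : Fin 4))) '' T₂ with hC₂
  -- the lists through a corner, and the loop they draw
  set T : Site 2 × Fin 4 → Set (List MedialVertex) := fun p ↦
    {γ | ∃ (h : IsInterfaceLoop ω γ) (i : ℕ), i < γ.length ∧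
      cSrc p = γ[i % γ.length]'(Nat.mod_lt _ h.length_pos) ∧
      cTgt p = γ[(i + 1) % γ.length]'(Nat.mod_lt _ h.length_pos)} with hT
  set u₀ : UnbasedLoop ℂ := UnbasedLoop.mk (BasedLoop.mk (loopCurve δ 0 [s((0 : Site 2), 0)])
    (isLoop_loopCurve δ 0 (List.cons_ne_nil _ _))) with hu₀
  set G : Site 2 × Fin 4 → UnbasedLoop ℂ := fun p ↦
    if hp : (T p).Nonempty then UnbasedLoop.mk (BasedLoop.mk (loopCurve δ 0 hp.some)
      (isLoop_loopCurve δ 0 hp.some_mem.1.ne_nil)) else u₀ with hG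
  -- a loop through the corner `p` is `G p`
  have hGp : ∀ (p : Site 2 × Fin 4) (γ : List MedialVertex) (hne : γ ≠ []), IsInterfaceLoop ω γ →
      (cSrc p, cTgt p) ∈ γ.zip (γ.rotate 1) →
      G p = UnbasedLoop.mk (BasedLoop.mk (loopCurve δ 0 γ) (isLoop_loopCurve δ 0 hne)) := by
    intro p γ hne h hp
    obtain ⟨i, hi, hps, hpt⟩ := h.exists_pos_of_mem_zip hp
    have hTp : (T p).Nonempty := ⟨γ, h, i, hi, hps, hpt⟩
    rw [hG]
    simp only [dif_pos hTp]
    obtain ⟨h₁, i₁, hi₁, hps₁, hpt₁⟩ := hTp.some_mem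
    have hrot := h₁.rotate_eq_of_corner h hi₁ hi hps₁ hpt₁ hps hpt
    have key := unbasedLoop_loopCurve_rotate δ 0 h₁.ne_nil (i₁ + hTp.some.length - i)
    have : UnbasedLoop.mk (BasedLoop.mk (loopCurve δ 0 (hTp.some.rotate (i₁ + hTp.some.length - i)))
        (isLoop_loopCurve δ 0 (by simpa using h₁.ne_nil))) =
        UnbasedLoop.mk (BasedLoop.mk (loopCurve δ 0 γ) (isLoop_loopCurve δ 0 hne)) := by
      congr 2
      exact congrArg _ hrot
    rw [← this, key]
  -- every big loop is `G` of a top corner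
  have hsub : {u ∈ (bondLoopConfig δ 0 ω).loops |
      u.range ⊆ Metric.ball (0 : ℂ) R ∧ η ≤ Metric.diam u.range} ⊆ G '' (C₁ ∪ C₂) := by
    rintro u ⟨hu, hballu, hdiamu⟩
    obtain ⟨⟨γ, hne⟩, h, rfl⟩ := (mem_loops_iff δ ω u).1 hu
    obtain ⟨hball₁, hdiam₁⟩ := big_at_mesh_one hδ hne hballu hdiamu
    rcases exists_topCorner_of_isInterfaceLoop ω γ (R / δ) (η / δ) s hω h hs hsD hball₁ hdiam₁ with
      ⟨x, hxB, htop, hmem⟩ | ⟨g, hgB, htop, hmem⟩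
    · exact ⟨(x, 0), Or.inl ⟨x, ⟨mem_box_ceil_of_norm_lt hxB, htop⟩, rfl⟩, hGp _ γ hne h hmem⟩
    · exact ⟨(g + Pi.single 1 1, 3), Or.inr ⟨g, ⟨mem_box_ceil_succ_of_norm_faceCenter_lt hgB, htop⟩,
        rfl⟩, hGp _ γ hne h hmem⟩
  calc {u ∈ (bondLoopConfig δ 0 ω).loops |
          u.range ⊆ Metric.ball (0 : ℂ) R ∧ η ≤ Metric.diam u.range}.encard
      ≤ (G '' (C₁ ∪ C₂)).encard := encard_le_encard hsub
    _ ≤ (C₁ ∪ C₂).encard := encard_image_le _ _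
    _ ≤ C₁.encard + C₂.encard := encard_union_le _ _
    _ ≤ T₁.encard + T₂.encard := add_le_add (encard_image_le _ _) (encard_image_le _ _)

/-- **Expected number of local tops in a box** (primal sites of `B(L₁)` and dual faces of
`B(L₂)`, any direction `u`, scale `s ≥ 1`): at most `(|B(L₁)| + |B(L₂)|) · C / s²`, by
`real_localTopEvent_le_of_one_le` and self-duality of `P_{1/2}`. [cite: Nolin2008, §5.2, proof of Thm 23 (arXiv 0711.4948 numbering; counting argument)] -/
theorem integral_topCount_le {C : ℝ}
    (hC : ∀ (u : Fin 2 → ℝ) (x : Site 2) (s : ℕ), 1 ≤ s →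
      (bondPercolation (zdGraph 2) half).real (localTopEvent u x s) ≤ C / (s : ℝ) ^ 2)
    (u : Fin 2 → ℝ) (L₁ L₂ : ℕ) {s : ℕ} (hs : 1 ≤ s) :
    Integrable (fun ω ↦ ∑ x ∈ box 2 L₁, (localTopEvent u x s).indicator (fun _ ↦ (1 : ℝ)) ω +
        ∑ g ∈ box 2 L₂, (dualConfig ⁻¹' localTopEvent u g s).indicator (fun _ ↦ (1 : ℝ)) ω) P2 ∧
      ∫ ω, (∑ x ∈ box 2 L₁, (localTopEvent u x s).indicator (fun _ ↦ (1 : ℝ)) ω +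
        ∑ g ∈ box 2 L₂, (dualConfig ⁻¹' localTopEvent u g s).indicator (fun _ ↦ (1 : ℝ)) ω) ∂P2 ≤
      (((box 2 L₁).card : ℝ) + (box 2 L₂).card) * (C / (s : ℝ) ^ 2) := by
  have hmeas₁ : ∀ x, MeasurableSet (localTopEvent u x s) := fun x ↦ measurableSet_localTopEvent u x s
  have hmeas₂ : ∀ g, MeasurableSet (dualConfig ⁻¹' localTopEvent u g s) := fun g ↦
    measurable_dualConfig (measurableSet_localTopEvent u g s)
  have hint₁ : Integrable (fun ω ↦ ∑ x ∈ box 2 L₁, (localTopEvent u x s).indicator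
      (fun _ ↦ (1 : ℝ)) ω) P2 :=
    integrable_finsetSum _ fun x _ ↦ (integrable_const _).indicator (hmeas₁ x)
  have hint₂ : Integrable (fun ω ↦ ∑ g ∈ box 2 L₂, (dualConfig ⁻¹' localTopEvent u g s).indicator
      (fun _ ↦ (1 : ℝ)) ω) P2 :=
    integrable_finsetSum _ fun g _ ↦ (integrable_const _).indicator (hmeas₂ g)
  refine ⟨hint₁.add hint₂, ?_⟩
  rw [integral_add hint₁ hint₂,
    integral_finsetSum _ fun x _ ↦ (integrable_const _).indicator (hmeas₁ x),
    integral_finsetSum _ fun g _ ↦ (integrable_const _).indicator (hmeas₂ g)]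
  simp only [integral_indicator_const _ (hmeas₁ _), integral_indicator_const _ (hmeas₂ _),
    smul_eq_mul, mul_one]
  rw [add_mul]
  refine add_le_add ?_ ?_
  · calc ∑ x ∈ box 2 L₁, P2.real (localTopEvent u x s) ≤ ∑ x ∈ box 2 L₁, C / (s : ℝ) ^ 2 :=
          Finset.sum_le_sum fun x _ ↦ hC u x s hs
      _ = ((box 2 L₁).card : ℝ) * (C / (s : ℝ) ^ 2) := by rw [Finset.sum_const, nsmul_eq_mul]
  · calc ∑ g ∈ box 2 L₂, P2.real (dualConfig ⁻¹' localTopEvent u g s)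
        ≤ ∑ g ∈ box 2 L₂, C / (s : ℝ) ^ 2 :=
          Finset.sum_le_sum fun g _ ↦ by
            change (bondPercolation (zdGraph 2) half).real _ ≤ _
            rw [real_preimage_dualConfig_localTopEvent]; exact hC u g s hs
      _ = ((box 2 L₂).card : ℝ) * (C / (s : ℝ) ^ 2) := by rw [Finset.sum_const, nsmul_eq_mul]

/-- The counting function equals the number of local tops (sites plus faces). [folklore] -/
theorem topCount_eq_card (u : Fin 2 → ℝ) (L₁ L₂ s : ℕ) (ω : BondConfig (Site 2)) :
    ∑ x ∈ box 2 L₁, (localTopEvent u x s).indicator (fun _ ↦ (1 : ℝ)) ω +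
        ∑ g ∈ box 2 L₂, (dualConfig ⁻¹' localTopEvent u g s).indicator (fun _ ↦ (1 : ℝ)) ω =
      (({x : Site 2 | x ∈ box 2 L₁ ∧ IsLocalTop u ω x s}.encard.toNat : ℕ) : ℝ) +
        (({g : Site 2 | g ∈ box 2 L₂ ∧ IsLocalTop u (dualConfig ω) g s}.encard.toNat : ℕ) : ℝ) := by
  classical
  have h1 : {x : Site 2 | x ∈ box 2 L₁ ∧ IsLocalTop u ω x s} =
      ↑((box 2 L₁).filter fun x ↦ IsLocalTop u ω x s) := by
    rw [Finset.coe_filter]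
  have h2 : {g : Site 2 | g ∈ box 2 L₂ ∧ IsLocalTop u (dualConfig ω) g s} =
      ↑((box 2 L₂).filter fun g ↦ IsLocalTop u (dualConfig ω) g s) := by
    rw [Finset.coe_filter]
  rw [h1, h2, encard_coe_eq_coe_finsetCard, encard_coe_eq_coe_finsetCard, ENat.toNat_coe,
    ENat.toNat_coe]
  simp only [Set.indicator_apply, localTopEvent, Set.mem_preimage, Set.mem_setOf_eq,
    Finset.sum_boole]

/-- **Tightness of the number of macroscopic interface loops of critical bond percolation on
`ℤ²`.** For every `R`, `η > 0`, `ε > 0` there is `N` such that, for all small meshes `δ`, with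
`P_{1/2}`-probability at least `1 - ε` at most `N` loops of `bondLoopConfig δ 0 ω` of diameter
`≥ η` have their trace in `B(0, R)`. Proof: on lattice configurations every such loop has a top
corner whose vertex (resp. face) is a local top of `ω` (resp. `dualConfig ω`) at scale
`s ≍ η/δ` in `B(0, R/δ + 2)` (`encard_bigLoops_le_encard_tops`); the expected number of local
tops is `≤ C (R/δ)² / s² = O(R²/η²)` uniformly in `δ` (`real_localTopEvent_le`, self-duality),
and Markov's inequality concludes. [cite: Nolin2008, §5.2, proof of Thm 23 (arXiv 0711.4948 numbering; counting argument)] -/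
theorem tight_encard_bigLoops_bondLoopConfig :
    ∀ (R η ε : ℝ), 0 < η → 0 < ε → ∃ N : ℕ, ∀ᶠ δ in 𝓝[>] (0 : ℝ),
      P2 {ω | (N : ℕ∞) < {u ∈ (bondLoopConfig δ 0 ω).loops |
        u.range ⊆ Metric.ball (0 : ℂ) R ∧ η ≤ Metric.diam u.range}.encard} ≤ ENNReal.ofReal ε := by
  intro R η ε hη hε
  obtain ⟨C, hC, hloc⟩ := real_localTopEvent_le_of_one_le
  set R' : ℝ := max R 1 with hR'
  have hR'1 : 1 ≤ R' := le_max_right R 1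
  set M₀ : ℝ := 6272 * C * R' ^ 2 / η ^ 2 with hM₀
  have hM₀nn : 0 ≤ M₀ := by positivity
  refine ⟨⌈M₀ / ε⌉₊, ?_⟩
  set N : ℕ := ⌈M₀ / ε⌉₊ with hN
  have hδ₀ : (0 : ℝ) < min 1 (η / 12) := lt_min one_pos (by positivity)
  filter_upwards [Ioo_mem_nhdsGT hδ₀] with δ hδ
  obtain ⟨hδpos, hδlt⟩ := hδ
  have hδ1 : δ < 1 := hδlt.trans_le (min_le_left _ _)
  have hδη : δ < η / 12 := hδlt.trans_le (min_le_right _ _)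
  -- the scale
  set D : ℝ := η / δ with hD
  have hD12 : 12 ≤ D := by
    rw [hD, le_div_iff₀ hδpos]
    rw [lt_div_iff₀ (by norm_num : (0 : ℝ) < 12)] at hδη
    linarith
  set s : ℕ := ⌊(D - 2) / 4⌋₊ with hs
  have hs1 : 1 ≤ s := Nat.le_floor (by push_cast; linarith)
  have hsD : (4 * s + 2 : ℝ) ≤ η / δ := by
    have := Nat.floor_le (show 0 ≤ (D - 2) / 4 by linarith)
    rw [← hs] at this
    rw [← hD]
    linarith
  have hsD' : D / 8 ≤ s := by
    have := Nat.lt_floor_add_one ((D - 2) / 4)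
    rw [← hs] at this
    linarith
  -- the counting function
  set L₁ : ℕ := ⌈R / δ⌉₊ with hL₁
  set f : BondConfig (Site 2) → ℝ := fun ω ↦
    ∑ x ∈ box 2 L₁, (localTopEvent ![0, 1] x s).indicator (fun _ ↦ (1 : ℝ)) ω +
      ∑ g ∈ box 2 (L₁ + 1), (dualConfig ⁻¹' localTopEvent ![0, 1] g s).indicator
        (fun _ ↦ (1 : ℝ)) ω with hf
  obtain ⟨hint, hle⟩ := integral_topCount_le hloc ![0, 1] L₁ (L₁ + 1) hs1
  -- Step 1: too many big loops force many local tops (on lattice configurations)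
  have hstep1 : {ω | (N : ℕ∞) < {u ∈ (bondLoopConfig δ 0 ω).loops |
        u.range ⊆ Metric.ball (0 : ℂ) R ∧ η ≤ Metric.diam u.range}.encard} ≤ᵐ[P2]
      {ω | ((N : ℝ) + 1) ≤ f ω} := by
    filter_upwards [ae_subset_edgeSet (zdGraph 2) half] with ω hω
    intro hE
    have hle' := encard_bigLoops_le_encard_tops (R := R) hδpos hs1 hsD hω
    set T₁ : Set (Site 2) := {x : Site 2 | x ∈ box 2 ⌈R / δ⌉₊ ∧ IsLocalTop ![0, 1] ω x s} with hT₁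
    set T₂ : Set (Site 2) := {g : Site 2 | g ∈ box 2 (⌈R / δ⌉₊ + 1) ∧
      IsLocalTop ![0, 1] (dualConfig ω) g s} with hT₂
    have hfin₁ : T₁.encard = (T₁.encard.toNat : ℕ∞) :=
      (ENat.coe_toNat (encard_ne_top_iff.2 ((box 2 ⌈R / δ⌉₊).finite_toSet.subset
        fun x hx ↦ hx.1))).symm
    have hfin₂ : T₂.encard = (T₂.encard.toNat : ℕ∞) :=
      (ENat.coe_toNat (encard_ne_top_iff.2 ((box 2 (⌈R / δ⌉₊ + 1)).finite_toSet.subset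
        fun x hx ↦ hx.1))).symm
    have hlt : (N : ℕ∞) < ((T₁.encard.toNat + T₂.encard.toNat : ℕ) : ℕ∞) := by
      rw [Nat.cast_add, ← hfin₁, ← hfin₂]
      exact hE.trans_le hle'
    have hlt' : N < T₁.encard.toNat + T₂.encard.toNat := by exact_mod_cast hlt
    change ((N : ℝ) + 1) ≤ f ω
    rw [hf]
    dsimp only
    rw [topCount_eq_card]
    exact_mod_cast Nat.succ_le_of_lt hlt'
  -- Step 2: Markov's inequality and the expected number of local tops
  have hmarkov := mul_meas_ge_le_integral_of_nonneg (μ := P2) (f := f)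
    (ae_of_all _ fun ω ↦ by
      rw [hf]
      dsimp only
      exact add_nonneg (Finset.sum_nonneg fun x _ ↦ Set.indicator_nonneg (fun _ _ ↦ zero_le_one) _)
        (Finset.sum_nonneg fun g _ ↦ Set.indicator_nonneg (fun _ _ ↦ zero_le_one) _))
    hint ((N : ℝ) + 1)
  -- Step 3: the bound is uniform in `δ`
  have hX : 1 ≤ R' / δ := (one_le_div hδpos).2 (hδ1.le.trans hR'1)
  have h1 : (⌈R / δ⌉₊ : ℝ) ≤ ⌈R' / δ⌉₊ := by
    exact_mod_cast Nat.ceil_mono (div_le_div_of_nonneg_right (le_max_left R 1) hδpos.le)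
  have h2 : (⌈R' / δ⌉₊ : ℝ) < R' / δ + 1 := Nat.ceil_lt_add_one (by positivity)
  have hcards : ((box 2 L₁).card : ℝ) + (box 2 (L₁ + 1)).card ≤ 98 * (R' / δ) ^ 2 := by
    rw [card_box, card_box, hL₁]
    push_cast
    have h3 : (0 : ℝ) ≤ 2 * ⌈R / δ⌉₊ + 1 := by positivity
    have h4 : (2 * ⌈R / δ⌉₊ + 1 : ℝ) ≤ 2 * (⌈R / δ⌉₊ + 1) + 1 := by linarith
    have h5 : (2 * (⌈R / δ⌉₊ + 1) + 1 : ℝ) ≤ 7 * (R' / δ) := by linarith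
    calc (2 * (⌈R / δ⌉₊ : ℝ) + 1) ^ 2 + (2 * ((⌈R / δ⌉₊ : ℝ) + 1) + 1) ^ 2
        ≤ (7 * (R' / δ)) ^ 2 + (7 * (R' / δ)) ^ 2 :=
          add_le_add (pow_le_pow_left₀ h3 (h4.trans h5) 2) (pow_le_pow_left₀ (by positivity) h5 2)
      _ = 98 * (R' / δ) ^ 2 := by ring
  have hsC : C / (s : ℝ) ^ 2 ≤ 64 * C / D ^ 2 := by
    calc C / (s : ℝ) ^ 2 ≤ C / (D / 8) ^ 2 :=
          div_le_div_of_nonneg_left hC.le (by positivity) (pow_le_pow_left₀ (by positivity) hsD' 2)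
      _ = 64 * C / D ^ 2 := by
          field_simp
          ring
  have hprod : (((box 2 L₁).card : ℝ) + (box 2 (L₁ + 1)).card) * (C / (s : ℝ) ^ 2) ≤ M₀ := by
    calc (((box 2 L₁).card : ℝ) + (box 2 (L₁ + 1)).card) * (C / (s : ℝ) ^ 2)
        ≤ (98 * (R' / δ) ^ 2) * (64 * C / D ^ 2) :=
          mul_le_mul hcards hsC (by positivity) (by positivity)
      _ = M₀ := by
          rw [hM₀, hD]
          field_simp
          ring
  have hreal : P2.real {ω | ((N : ℝ) + 1) ≤ f ω} ≤ ε := by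
    have hN1 : (0 : ℝ) < (N : ℝ) + 1 := by positivity
    have hNε : M₀ < ε * ((N : ℝ) + 1) := by
      have := Nat.le_ceil (M₀ / ε)
      rw [← hN, div_le_iff₀ hε] at this
      nlinarith
    have : ((N : ℝ) + 1) * P2.real {ω | ((N : ℝ) + 1) ≤ f ω} ≤ M₀ :=
      hmarkov.trans (hle.trans hprod)
    nlinarith [measureReal_nonneg (μ := P2) (s := {ω | ((N : ℝ) + 1) ≤ f ω})]
  -- conclusion
  calc P2 {ω | (N : ℕ∞) < {u ∈ (bondLoopConfig δ 0 ω).loops |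
          u.range ⊆ Metric.ball (0 : ℂ) R ∧ η ≤ Metric.diam u.range}.encard}
      ≤ P2 {ω | ((N : ℝ) + 1) ≤ f ω} := measure_mono_ae hstep1
    _ = ENNReal.ofReal (P2.real {ω | ((N : ℝ) + 1) ≤ f ω}) :=
        (ofReal_measureReal (measure_ne_top _ _)).symm
    _ ≤ ENNReal.ofReal ε := ENNReal.ofReal_le_ofReal hreal

end Summit.CriticalPhenomena.CardyFormulaZ2.Cruxes.NestingRigidity.MarkovCascadeOneGeneration

end
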